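import Summits.ResolutionOfSingularities.ResolutionOfSingularities.Theorems.RadicialJungCleanModelsCcurveLiftStep
import Literature.AlgebraicGeometry.Resolution.QuadraticTransformsFactorization
import Summits.ResolutionOfSingularities.ResolutionOfSingularities.Theorems.RadicialJungCleanModelsCcurveLiftOf
import HarnessLib

/-!
# [GENERAL-FIELD VERSION `lift_of_gen` (lead g7, towards Sketch rev 30): the `[PerfectField k]` binder of the original is REMOVED; the proof is unchanged.]
# Route `RadicialJung`, crux `CleanModels` (stmt-15917) — (C-curve) sub-line: the lift `stub_Cc_lift` modulo the shared stub `stub_Cc_centreCurve`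

Lead `res-B-lead-1` g6 (plan `Cruxes/CleanModels/Lines/Sketch-memo-Ccurve-plan.md` §1 S2–S4; workfile `Lines/Sketch_Ccurve_assembly.lean` v2.8).  OURS · counted 0.
Nothing here proves resolution in characteristic `p`; resolution in char `p` is NOT proved.

`lift_of (hS3)`: the statement of `stub_Cc_lift` (a 2-dimensional regular local ring `R₁` dominating `R₀ = locAtCentre B O₁` and dominated by `O₁` is
`locAtCentre B′ O₁` for a model `B′ ⊇ B` regular of dimension 3 at the centre of `O`) from the shared stub S3 `stub_Cc_centreCurve` taken as a closed hypothesis.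
Proof: Abhyankar's factorisation (✓ `AbhyankarQuadraticFactorization_holds`) writes `R₀ → ⋯ → R₁` as a chain of quadratic transforms; induction along the chain
with the invariant «`T` is regular of dimension 2, a local ring of `K`, and `= locAtCentre B_T O₁` for a model `B_T`»: S3 adapts the model, ✓ `Ccurve.lift_step` blows
up the regular centre curve and realises THE quadratic transform of `T` along `O₁`, which is the next ring of the chain by uniqueness (✓ `IsQuadraticTransformAlong.unique`,
✓ `IsQuadraticTransform.along`); it is regular of dimension 2 by ✓ `exists_quadraticTransform_dominated` (Huneke–Swanson 14.5.2) and uniqueness again.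
-/

noncomputable section

set_option linter.dupNamespace false

open IsLocalRing Literature.AlgebraicGeometry.Resolution
open Summit.ResolutionOfSingularities.ResolutionOfSingularities.Theorems

namespace Summit.ResolutionOfSingularities.ResolutionOfSingularities.Theorems.RadicialJung.CleanModels.Ccurve

/-- **`stub_Cc_lift` modulo the shared stub `stub_Cc_centreCurve` (S3).**  See the module docstring. [folklore; cite: Cutkosky2014, Thm. 2.1] -/
theorem lift_of_gen
    (hS3 :
    ∀ (k : Type) [Field k] (K : Type) [Field K] [Algebra k K]
    (O : ValuationSubring K) (A : Subalgebra k K), A.toSubring ≤ O.toSubring → A.FG → IsFractionRing A K → ringKrullDim A ≤ 3 →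
    (∀ (T : Subring K) (hT : T ≤ O.toSubring), A.toSubring ≤ T → (subringCentre T O hT).IsMaximal) →
    ∀ (B : Subalgebra k K) (hBO : B.toSubring ≤ O.toSubring), A ≤ B → B.FG →
    IsRegularLocalRing (locAtCentre B.toSubring O) → ringKrullDim (locAtCentre B.toSubring O) = 3 →
    ∀ (O₁ : ValuationSubring K), O ≤ O₁ → ringKrullDim (locAtCentre B.toSubring O₁) = 2 →
    ∃ (B' : Subalgebra k K) (hB'O : B'.toSubring ≤ O.toSubring), B ≤ B' ∧ B'.FG ∧
    IsRegularLocalRing (locAtCentre B'.toSubring O) ∧ ringKrullDim (locAtCentre B'.toSubring O) = 3 ∧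
    locAtCentre B'.toSubring O₁ = locAtCentre B.toSubring O₁ ∧
    ∃ (x y z : K) (hx : x ∈ locAtCentre B'.toSubring O) (hy : y ∈ locAtCentre B'.toSubring O) (hz : z ∈ locAtCentre B'.toSubring O),
      (haveI := isLocalRing_locAtCentre hB'O; IsLocalRing.maximalIdeal (locAtCentre B'.toSubring O)) =
        Ideal.span {⟨x, hx⟩, ⟨y, hy⟩, ⟨z, hz⟩} ∧
      ∀ w : ↥(locAtCentre B'.toSubring O), O₁.valuation (w : K) < 1 ↔ w ∈ Ideal.span {(⟨x, hx⟩ : ↥(locAtCentre B'.toSubring O)), ⟨y, hy⟩} ) :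
    ∀ (p : ℕ), p.Prime →
    ∀ (k : Type) [Field k] [CharP k p] (K : Type) [Field K] [Algebra k K]
    (O : ValuationSubring K) (A : Subalgebra k K), A.toSubring ≤ O.toSubring → A.FG → IsFractionRing A K →
    ringKrullDim A ≤ 3 → IsRegularLocalRing (locAtCentre A.toSubring O) →
    ringKrullDim (locAtCentre A.toSubring O) = 3 →
    (∀ (T : Subring K) (hT : T ≤ O.toSubring), A.toSubring ≤ T → (subringCentre T O hT).IsMaximal) →
    ∀ g₀ : K, (∀ c : K, c ^ p ≠ g₀) →
    ¬ (∃ (O₁ : ValuationSubring K), O ≤ O₁ ∧ O₁ ≠ ⊤ ∧ ∃ y : Fin 2 → K, (∀ i, y i ∈ O) ∧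
      ∀ P : MvPolynomial (Fin 2) k, P ≠ 0 → O₁.valuation (MvPolynomial.aeval y P) = 1) →
    ∀ (O₁ : ValuationSubring K), O ≤ O₁ → O₁ ≠ O → O₁ ≠ ⊤ →
    ∀ (B : Subalgebra k K), B.toSubring ≤ O.toSubring → A ≤ B → B.FG →
    IsRegularLocalRing (locAtCentre B.toSubring O) → ringKrullDim (locAtCentre B.toSubring O) = 3 →
    IsRegularLocalRing (locAtCentre B.toSubring O₁) → ringKrullDim (locAtCentre B.toSubring O₁) = 2 →
    IsLocalRingOf (locAtCentre B.toSubring O₁) →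
    ∀ (R₁ : Subring K), R₁ ≤ O₁.toSubring → SubringDominates (locAtCentre B.toSubring O₁) R₁ → SubringDominates R₁ O₁.toSubring →
    IsRegularLocalRing ↥R₁ → ringKrullDim ↥R₁ = 2 →
    ∃ (B' : Subalgebra k K), B'.toSubring ≤ O.toSubring ∧ B ≤ B' ∧ B'.FG ∧
    IsRegularLocalRing (locAtCentre B'.toSubring O) ∧ ringKrullDim (locAtCentre B'.toSubring O) = 3 ∧
    locAtCentre B'.toSubring O₁ = R₁ := by
  intro p hp k _ _ K _ _ O A hAO hAfg hfrac hdimA hreg hdim3 hzd g₀ hg₀ hdiv O₁ hOO₁ hne hO₁ B hBO hAB hBfg hBreg hBdim hBreg₁ hBdim₁ hLRO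
    R₁ hR₁O₁ hdom₀ hdom₁ hR₁reg hR₁dim
  classical
  haveI := hfrac
  have hchain : Relation.ReflTransGen IsQuadraticTransform (locAtCentre B.toSubring O₁) R₁ :=
    AbhyankarQuadraticFactorization_holds K (locAtCentre B.toSubring O₁) R₁ hBreg₁ hBdim₁ hLRO hR₁reg hR₁dim hdom₀
  suffices H : ∀ S' : Subring K, Relation.ReflTransGen IsQuadraticTransform (locAtCentre B.toSubring O₁) S' → SubringDominates S' R₁ →
      (IsRegularLocalRing ↥S' ∧ ringKrullDim ↥S' = 2 ∧ IsLocalRingOf S' ∧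
       ∃ (B' : Subalgebra k K), B'.toSubring ≤ O.toSubring ∧ B ≤ B' ∧ B'.FG ∧
         IsRegularLocalRing (locAtCentre B'.toSubring O) ∧ ringKrullDim (locAtCentre B'.toSubring O) = 3 ∧
         locAtCentre B'.toSubring O₁ = S') by
    obtain ⟨-, -, -, B', h1, h2, h3, h4, h5, h6⟩ := H R₁ hchain (SubringDominates.refl R₁)
    exact ⟨B', h1, h2, h3, h4, h5, h6⟩
  intro S' hS'
  induction hS' with
  | refl =>
    intro _
    exact ⟨hBreg₁, hBdim₁, hLRO, B, hBO, le_rfl, hBfg, hBreg, hBdim, rfl⟩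
  | @tail T S'' _ hq ih =>
    intro hS''R₁
    have hTR₁ : SubringDominates T R₁ := hq.dominates.trans hS''R₁
    obtain ⟨hTreg, hTdim, hTof, B_T, hB_TO, hBB_T, hB_Tfg, hB_Treg, hB_Tdim, hlocT⟩ := ih hTR₁
    haveI : IsRegularLocalRing ↥T := hTreg
    -- the model adapted to the centre curve (S3)
    obtain ⟨B', hB'O, hB_TB', hB'fg, hB'reg, hB'dim, hloc', x, y, z, hx, hy, hz, hmax, hcen⟩ :=
      hS3 k K O A hAO hAfg hfrac hdimA hzd B_T hB_TO (hAB.trans hBB_T) hB_Tfg hB_Treg hB_Tdim O₁ hOO₁ (by rw [hlocT]; exact hTdim)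
    have hlocB'T : locAtCentre B'.toSubring O₁ = T := hloc'.trans hlocT
    have hAB' : A ≤ B' := (hAB.trans hBB_T).trans hB_TB'
    -- the quadratic transform `S''` is along `O₁`, as is the one realised by the curve blow-up
    have hS''O₁ : SubringDominates S'' O₁.toSubring := hS''R₁.trans hdom₁
    have hfgT : ∃ _ : IsLocalRing ↥T, (maximalIdeal ↥T).FG := ⟨inferInstance, IsNoetherian.noetherian _⟩
    have hq' : IsQuadraticTransformAlong O₁ T S'' := hq.along hfgT hS''O₁
    -- `S''` is regular of dimension `2`: it is the Huneke–Swanson step towards `R₁`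
    have hTne : T ≠ R₁ := by
      intro hTR
      apply not_subringDominates_of_isQuadraticTransform hTreg hTdim hq
      rw [hTR]; exact hS''R₁
    obtain ⟨Q, hQt, hQreg, hQdim, hQof, hQdom⟩ := exists_quadraticTransform_dominated hTreg hTdim hTof hR₁reg hR₁dim hTR₁ hTne
    have hQ' : IsQuadraticTransformAlong O₁ T Q := hQt.along hfgT (hQdom.trans hdom₁)
    have hQS : Q = S'' := hQ'.unique hq'
    rw [hQS] at hQreg hQdim hQof
    -- the model realising `S''`
    have hmodel : ∃ (B'' : Subalgebra k K), B''.toSubring ≤ O.toSubring ∧ B ≤ B'' ∧ B''.FG ∧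
        IsRegularLocalRing (locAtCentre B''.toSubring O) ∧ ringKrullDim (locAtCentre B''.toSubring O) = 3 ∧
        locAtCentre B''.toSubring O₁ = S'' := by
      rcases le_total (O.valuation x) (O.valuation y) with hxy | hyx
      · obtain ⟨B'', hB''O, hB'B'', hB''fg, hB''reg, hB''dim, -, hqt⟩ :=
          lift_step k K O A hAO hAfg hfrac hzd B' hB'O hAB' hB'fg hB'reg hB'dim O₁ hOO₁ x y z hx hy hz hmax hcen hxy
        rw [hlocB'T] at hqt
        exact ⟨B'', hB''O, (hBB_T.trans hB_TB').trans hB'B'', hB''fg, hB''reg, hB''dim, (hq'.unique hqt).symm⟩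
      · have hmax' : (haveI := isLocalRing_locAtCentre hB'O; IsLocalRing.maximalIdeal (locAtCentre B'.toSubring O)) =
            Ideal.span {⟨y, hy⟩, ⟨x, hx⟩, ⟨z, hz⟩} := by
          rw [hmax]; congr 1; ext v; simp only [Set.mem_insert_iff, Set.mem_singleton_iff]; tauto
        have hcen' : ∀ w : ↥(locAtCentre B'.toSubring O), O₁.valuation (w : K) < 1 ↔
            w ∈ Ideal.span {(⟨y, hy⟩ : ↥(locAtCentre B'.toSubring O)), ⟨x, hx⟩} := by
          intro w; rw [hcen w, Set.pair_comm]
        obtain ⟨B'', hB''O, hB'B'', hB''fg, hB''reg, hB''dim, -, hqt⟩ :=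
          lift_step k K O A hAO hAfg hfrac hzd B' hB'O hAB' hB'fg hB'reg hB'dim O₁ hOO₁ y x z hy hx hz hmax' hcen' hyx
        rw [hlocB'T] at hqt
        exact ⟨B'', hB''O, (hBB_T.trans hB_TB').trans hB'B'', hB''fg, hB''reg, hB''dim, (hq'.unique hqt).symm⟩
    exact ⟨hQreg, hQdim, hQof, hmodel⟩

end Summit.ResolutionOfSingularities.ResolutionOfSingularities.Theorems.RadicialJung.CleanModels.Ccurve

end
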